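import Literature.MathematicalPhysics.QuantumLattice.GrassmannWeightedLaplacianTruncatedBoundPrescribed
import Literature.MathematicalPhysics.QuantumLattice.GrassmannWeightedCumulantBoundDB
import HarnessLib

/-!
# The decay-WEIGHTED `L¹–L^∞` bound for the kernels of `𝓔ᵀ_C(V; n)` with PRESCRIBED output legs

Topic `Literature/MathematicalPhysics/QuantumLattice`; the `IsTreeWeight wt`-weighted twin of `GrassmannCumulantKernelBoundPrescribed`
(Benfatto–Giuliani–Mastropietro 2006, (2.13)–(2.14) with (2.77)–(2.80), §3 (3.2)–(3.8) and the sectorised bookkeeping of §2.4, Lemma 2.6;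
Gawȩdzki–Kupiainen 1985; Gentile–Mastropietro 2001, §4), obtained from the weighted kernel-vertex bound
`sum_wt_norm_kernel_ursellOf_kernelVertex_le_prescribed` exactly as `GrassmannWeightedCumulantBoundDB.sum_wt_norm_kernel_cumulantOf_le_of_gramBounded`
is obtained from the unrestricted one: replicas (the weight pulled back along `Prod.snd`, the prescriptions read on `Prod.snd`), collapse,
multilinearity.  One output label pinned, the output labels of the slots `j ∈ J` constrained to `A j`, the others summed against the
weight `wt` of the output label set; input `a` of a landing profile `φ` enters with its `wt`-WEIGHTED anchored norm `N(δ_a, |φ⁻¹ a|)`.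

* (private) `sum_filter_wt_norm_kernel_collapse_le_prescribed`, `sum_filter_wt_norm_replicaKer_le_prescribed`;
* **`sum_wt_norm_kernel_cumulantOf_le_prescribed_of_gramBounded`**.

Everything is proved; no definition, no named fact.

## Sources

G. Benfatto, A. Giuliani, V. Mastropietro, Ann. Henri Poincaré 7 (2006) 809–898, (2.13)–(2.14), (2.66)–(2.80), §2.4 Lemma 2.6,
§3 (3.2)–(3.8) [`BenfattoGiulianiMastropietro2006`]; G. Gentile, V. Mastropietro, Phys. Rep. 352 (2001) 273–437, §4 [`GentileMastropietro2001`];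
K. Gawȩdzki, A. Kupiainen, Comm. Math. Phys. 102 (1985) 1–30, §3 [`GawedzkiKupiainen1985GrossNeveu`].
-/

noncomputable section

namespace Literature.MathematicalPhysics.QuantumLattice

open GrassmannAlgebra Finset MvPolynomial Literature.RingTheory.MvPolynomial
open Literature.Probability.LatticeModels Literature.Probability.LatticeModels.BattleFederbush
open Literature.MeasureTheory.Integral
open scoped InnerProductSpace

universe u

/-! ### Collapse and replicas with constrained slots -/

section Helpers

variable {𝕜 : Type*} [RCLike 𝕜] {Γ : Type u} [Fintype Γ] [DecidableEq Γ] {n : ℕ} {wt : Finset Γ → ℝ}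

/-- **The weighted constrained pinned sums of the kernels of a collapsed element**:
`Σ_{X : X_i = w, A_j(X_j)} wt(X) ‖kernel (collapse snd F) m X‖ ≤ Σ_b Σ_{X' : X'_i = (b, w), A_j((X'_j).2)} wt(snd X') ‖kernel F m X'‖`. [folklore] -/
private theorem sum_filter_wt_norm_kernel_collapse_le_prescribed (hwt : IsTreeWeight wt) (F : GrassmannAlgebra 𝕜 (Fin n × Γ)) {m : ℕ}
    (i : Fin m) (w : Γ) (J : Finset (Fin m)) (A : Fin m → Γ → Bool) :
    ∑ X ∈ univ.filter (fun X : Fin m → Γ => X i = w ∧ ∀ j ∈ J, A j (X j) = true),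
        wt (univ.image X) * ‖kernel 𝕜 (collapse 𝕜 (Prod.snd : Fin n × Γ → Γ) F) m X‖ ≤
      ∑ b : Fin n, ∑ X' ∈ univ.filter (fun X' : Fin m → Fin n × Γ => X' i = (b, w) ∧ ∀ j ∈ J, A j (X' j).2 = true),
        wt ((univ.image X').image Prod.snd) * ‖kernel 𝕜 F m X'‖ := by
  have himg : ∀ (X : Fin m → Γ) (X' : Fin m → Fin n × Γ), (∀ j, (X' j).2 = X j) → (univ.image X').image Prod.snd = univ.image X := by
    intro X X' h
    rw [image_image, show Prod.snd ∘ X' = X from funext h]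
  calc ∑ X ∈ univ.filter (fun X : Fin m → Γ => X i = w ∧ ∀ j ∈ J, A j (X j) = true),
          wt (univ.image X) * ‖kernel 𝕜 (collapse 𝕜 (Prod.snd : Fin n × Γ → Γ) F) m X‖
      ≤ ∑ X ∈ univ.filter (fun X : Fin m → Γ => X i = w ∧ ∀ j ∈ J, A j (X j) = true),
          ∑ X' ∈ univ.filter (fun X' : Fin m → Fin n × Γ => ∀ j, (X' j).2 = X j),
            wt ((univ.image X').image Prod.snd) * ‖kernel 𝕜 F m X'‖ := by
        refine sum_le_sum fun X _ => ?_
        rw [kernel_collapse]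
        refine (mul_le_mul_of_nonneg_left (norm_sum_le _ _) (hwt.nonneg _)).trans (le_of_eq ?_)
        rw [mul_sum]
        exact sum_congr rfl fun X' hX' => by rw [himg X X' (mem_filter.1 hX').2]
    _ = ∑ X ∈ univ.filter (fun X : Fin m → Γ => X i = w ∧ ∀ j ∈ J, A j (X j) = true),
          ∑ X' ∈ (univ.filter fun X' : Fin m → Fin n × Γ => (X' i).2 = w ∧ ∀ j ∈ J, A j (X' j).2 = true).filter
            (fun X' => (fun j => (X' j).2) = X), wt ((univ.image X').image Prod.snd) * ‖kernel 𝕜 F m X'‖ := by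
        refine sum_congr rfl fun X hX => sum_congr ?_ fun _ _ => rfl
        ext X'
        simp only [mem_filter, mem_univ, true_and, funext_iff]
        constructor
        · intro h
          obtain ⟨hXi, hXJ⟩ := (mem_filter.1 hX).2
          exact ⟨⟨by rw [h i]; exact hXi, fun j hj => by rw [h j]; exact hXJ j hj⟩, h⟩
        · exact fun h => h.2
    _ = ∑ X' ∈ univ.filter (fun X' : Fin m → Fin n × Γ => (X' i).2 = w ∧ ∀ j ∈ J, A j (X' j).2 = true),
          wt ((univ.image X').image Prod.snd) * ‖kernel 𝕜 F m X'‖ := by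
        refine sum_fiberwise_of_maps_to (fun X' hX' => ?_) _
        rw [mem_filter] at hX' ⊢
        exact ⟨mem_univ _, hX'.2.1, hX'.2.2⟩
    _ = ∑ b : Fin n, ∑ X' ∈ (univ.filter fun X' : Fin m → Fin n × Γ => (X' i).2 = w ∧ ∀ j ∈ J, A j (X' j).2 = true).filter
          (fun X' => (X' i).1 = b), wt ((univ.image X').image Prod.snd) * ‖kernel 𝕜 F m X'‖ :=
        (sum_fiberwise _ (fun X' : Fin m → Fin n × Γ => (X' i).1) _).symm
    _ = ∑ b : Fin n, ∑ X' ∈ univ.filter (fun X' : Fin m → Fin n × Γ => X' i = (b, w) ∧ ∀ j ∈ J, A j (X' j).2 = true),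
          wt ((univ.image X').image Prod.snd) * ‖kernel 𝕜 F m X'‖ := by
        refine sum_congr rfl fun b _ => sum_congr ?_ fun _ _ => rfl
        ext X'
        simp only [mem_filter, mem_univ, true_and, Prod.ext_iff]
        tauto

/-- **The weighted constrained anchored sums of a replica kernel are those of the kernel** (zero in the other copies). [folklore] -/
private theorem sum_filter_wt_norm_replicaKer_le_prescribed (hwt : IsTreeWeight wt) {m : ℕ} (K : (Fin m → Γ) → 𝕜) (a : Fin n) {r : ℕ}
    (A : Fin r → Γ → Bool) (T : Finset (Fin r)) (ι : T → Fin m) (t : Fin m) {N : ℝ}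
    (hN : ∀ w : Γ, ∑ Y ∈ univ.filter (fun Y : Fin m → Γ => Y t = w),
      ‖K Y‖ * wt (univ.image Y) * ∏ j : T, (if A j (Y (ι j)) = true then (1 : ℝ) else 0) ≤ N)
    (bw : Fin n × Γ) :
    ∑ Y' ∈ univ.filter (fun Y' : Fin m → Fin n × Γ => Y' t = bw),
        ‖replicaKer 𝕜 K a Y'‖ * wt ((univ.image Y').image Prod.snd) * ∏ j : T, (if A j (Y' (ι j)).2 = true then (1 : ℝ) else 0) ≤ N := by
  have hzero : ∀ Y' : Fin m → Fin n × Γ, Y' ∉ univ.map (copyEmb a) → ‖replicaKer 𝕜 K a Y'‖ = 0 := by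
    intro Y' hY'
    rw [← filter_forall_fst_eq, mem_filter, not_and] at hY'
    rw [replicaKer, if_neg (hY' (mem_univ _)), norm_zero]
  have himg : ∀ Y : Fin m → Γ, (univ.image (copyEmb (n := n) a Y)).image Prod.snd = univ.image Y := fun Y => by
    rw [image_image]; rfl
  calc ∑ Y' ∈ univ.filter (fun Y' : Fin m → Fin n × Γ => Y' t = bw),
          ‖replicaKer 𝕜 K a Y'‖ * wt ((univ.image Y').image Prod.snd) * ∏ j : T, (if A j (Y' (ι j)).2 = true then (1 : ℝ) else 0)
      = ∑ Y' ∈ (univ.map (copyEmb (m := m) a)).filter (fun Y' => Y' t = bw),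
          ‖replicaKer 𝕜 K a Y'‖ * wt ((univ.image Y').image Prod.snd) * ∏ j : T, (if A j (Y' (ι j)).2 = true then (1 : ℝ) else 0) := by
        symm
        refine sum_subset (filter_subset_filter _ (subset_univ _)) fun Y' hY' hY'2 => ?_
        rw [hzero Y' fun hmem => hY'2 (mem_filter.2 ⟨hmem, (mem_filter.1 hY').2⟩), zero_mul, zero_mul]
    _ = ∑ Y ∈ univ.filter (fun Y : Fin m → Γ => copyEmb (n := n) a Y t = bw),
          ‖K Y‖ * wt (univ.image Y) * ∏ j : T, (if A j (Y (ι j)) = true then (1 : ℝ) else 0) := by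
        rw [filter_map, sum_map]
        exact sum_congr rfl fun Y _ => by rw [replicaKer_copyEmb, himg]; rfl
    _ ≤ ∑ Y ∈ univ.filter (fun Y : Fin m → Γ => Y t = bw.2),
          ‖K Y‖ * wt (univ.image Y) * ∏ j : T, (if A j (Y (ι j)) = true then (1 : ℝ) else 0) := by
        refine sum_le_sum_of_subset_of_nonneg (fun Y hY => ?_) fun Y _ _ =>
          mul_nonneg (mul_nonneg (norm_nonneg _) (hwt.nonneg _)) (prod_nonneg fun j _ => by split_ifs <;> norm_num)
        rw [mem_filter] at hY ⊢
        exact ⟨mem_univ _, by rw [← hY.2]; rfl⟩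
    _ ≤ N := hN bw.2

end Helpers

/-! ### The bound -/

variable {𝕜 : Type*} [RCLike 𝕜] {Γ : Type u} [Fintype Γ] [DecidableEq Γ] {n : ℕ} {wt : Finset Γ → ℝ} (C : Matrix Γ Γ 𝕜)

/-- **The decay-weighted `L¹–L^∞` bound for the kernels of `𝓔ᵀ_C(V; n)` with prescribed output legs** (Benfatto–Giuliani–Mastropietro
2006, (2.13)–(2.14) with (2.77)–(2.80), §3 (3.2)–(3.8) and Lemma 2.6; Gawȩdzki–Kupiainen 1985): for a tree weight `wt`,
`V = Σ_{m' ∈ degs} Σ_Y K_{m'}(Y) ψ(Y)` whose kernels have `wt`-WEIGHTED anchored `L¹` norms with `F` further legs constrained to the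
prescribed predicates `≤ N(m', F)`, a charged replica-Gram-bounded covariance (constant `κ`), one-copy row and column sums of
`‖C(X,Y)‖ wt{X,Y}` at most `α`, and any positive `λ_δ`: one output label pinned, the labels of the slots `j ∈ J` constrained to `A j`,
the others summed against the weight of the output label set,
`Σ_W wt(W) ‖kernel_r 𝓔ᵀ_C(V; n)(W)‖ ≤ n · Σ_δ [r + 2(n-1) ≤ N_δ] (r!)⁻¹ (∏_{j∉J}(N_δ-j)) κ^{N_δ-r-2(n-1)} ·
(Σ_{φ : J → Fin n} (∏_j 2δ_{φ j}) ∏_a N(δ_a, |φ⁻¹ a|)) · λ_δ^{-(n-1)} ∏_ℓ (1 + λ_δ α (2δ)(2δ')_ℓ)`.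
[cite: BenfattoGiulianiMastropietro2006, (2.13)-(2.14), (2.77)-(2.80), §3 (3.2)-(3.8) and Lemma 2.6] -/
theorem sum_wt_norm_kernel_cumulantOf_le_prescribed_of_gramBounded (hwt : IsTreeWeight wt) {κ : ℝ} (hκ : 0 ≤ κ)
    (hGB : IsGramBoundedR C κ)
    (degs : Finset ℕ) (K : (m' : ℕ) → (Fin (2 * m') → Γ) → 𝕜) {r : ℕ} (J : Finset (Fin r)) (A : Fin r → Γ → Bool)
    (N : ℕ → ℕ → ℝ) (hN0 : ∀ m' F, 0 ≤ N m' F)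
    (hN : ∀ (m' : ℕ) (T : Finset (Fin r)), T ⊆ J → ∀ (ι : T → Fin (2 * m')), Function.Injective ι →
      ∀ (t : Fin (2 * m')), (∀ j, ι j ≠ t) → ∀ a : Γ,
        ∑ Y ∈ univ.filter (fun Y : Fin (2 * m') → Γ => Y t = a),
          ‖K m' Y‖ * wt (univ.image Y) * ∏ j : T, (if A j (Y (ι j)) = true then (1 : ℝ) else 0) ≤ N m' T.card)
    {α : ℝ} (hα : 0 ≤ α) (hrow : ∀ X, ∑ Y, ‖C X Y‖ * wt {X, Y} ≤ α) (hcol : ∀ Y, ∑ X, ‖C X Y‖ * wt {X, Y} ≤ α)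
    (lam : (Fin n → ℕ) → ℝ) (hlam : ∀ δ, 0 < lam δ) (hn : 0 < n) (i : Fin r) (hi : i ∉ J) (w : Γ) :
    ∑ W ∈ univ.filter (fun W : Fin r → Γ => W i = w ∧ ∀ j ∈ J, A j (W j) = true), wt (univ.image W) *
        ‖kernel 𝕜 ((cumulantOf (fun k => evenGaussConv 𝕜 C (vertexOf 𝕜 degs K ^ k)) n : evenPart 𝕜 Γ) : GrassmannAlgebra 𝕜 Γ) r W‖ ≤
      (n : ℝ) * ∑ δ ∈ Fintype.piFinset (fun _ : Fin n => degs),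
        (if r + 2 * (n - 1) ≤ ∑ a, 2 * δ a then
          ((((r.factorial : ℝ))⁻¹ * ((∏ j ∈ univ.filter (fun j : Fin r => j ∉ J), ((∑ a, 2 * δ a) - (j : ℕ)) : ℕ) : ℝ)) *
              κ ^ ((∑ a, 2 * δ a) - (r + 2 * (n - 1))) *
              ∑ φ : J → Fin n, (∏ j, ((2 * δ (φ j) : ℕ) : ℝ)) * ∏ a, N (δ a) (univ.filter fun j : J => φ j = a).card) *
            ((lam δ)⁻¹ ^ (n - 1) * ∏ ℓ : Sym2 (Fin n), (1 + lam δ * (α * (pairDeg (fun a => 2 * δ a) ℓ : ℝ))))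
        else 0) := by
  set C' : Matrix (Fin n × Γ) (Fin n × Γ) 𝕜 := C.submatrix Prod.snd Prod.snd with hC'
  have huniv : (univ : Finset (Fin n)).Nonempty := ⟨⟨0, hn⟩, mem_univ _⟩
  -- the replica weight
  have hwt' : IsTreeWeight (fun S' : Finset (Fin n × Γ) => wt (S'.image Prod.snd)) := hwt.comap Prod.snd
  -- the bound per degree assignment (abbreviation)
  set B : (Fin n → ℕ) → ℝ := fun δ =>
    if r + 2 * (n - 1) ≤ ∑ a, 2 * δ a then
      ((((r.factorial : ℝ))⁻¹ * ((∏ j ∈ univ.filter (fun j : Fin r => j ∉ J), ((∑ a, 2 * δ a) - (j : ℕ)) : ℕ) : ℝ)) *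
          κ ^ ((∑ a, 2 * δ a) - (r + 2 * (n - 1))) *
          ∑ φ : J → Fin n, (∏ j, ((2 * δ (φ j) : ℕ) : ℝ)) * ∏ a, N (δ a) (univ.filter fun j : J => φ j = a).card) *
        ((lam δ)⁻¹ ^ (n - 1) * ∏ ℓ : Sym2 (Fin n), (1 + lam δ * (α * (pairDeg (fun a => 2 * δ a) ℓ : ℝ))))
    else 0 with hB
  -- the degree-`δ` replica families
  set U : (Fin n → ℕ) → evenPart 𝕜 (Fin n × Γ) := fun δ => ursellOf (convMoment 𝕜 C'
    (kernelVertex 𝕜 (deg := fun b : Fin n => 2 * δ b) (fun b => even_two_mul (δ b)) fun b => replicaKer 𝕜 (K (δ b)) b)) univ with hU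
  -- replicas, collapse and multilinearity
  have hcum : ((cumulantOf (fun k => evenGaussConv 𝕜 C (vertexOf 𝕜 degs K ^ k)) n : evenPart 𝕜 Γ) : GrassmannAlgebra 𝕜 Γ) =
      ∑ δ ∈ Fintype.piFinset (fun _ : Fin n => degs), collapse 𝕜 (Prod.snd : Fin n × Γ → Γ) (U δ : GrassmannAlgebra 𝕜 (Fin n × Γ)) := by
    have h1 := collapseEven_ursellOf_convMoment_eq_cumulantOf 𝕜 (Prod.snd : Fin n × Γ → Γ) C (replicaVertex 𝕜 degs K)
      (vertexOf 𝕜 degs K) (collapseEven_replicaVertex 𝕜 degs K) huniv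
    rw [card_univ, Fintype.card_fin] at h1
    rw [← h1, coe_collapseEven]
    have h2 : ursellOf (convMoment 𝕜 C' (replicaVertex 𝕜 degs K)) univ = ∑ δ ∈ Fintype.piFinset (fun _ : Fin n => degs), U δ := by
      have h := ursellOf_convMoment_eq_sum_piFinset 𝕜 C' (Prod.fst : Fin n × Γ → Fin n) (fun _ : Fin n => degs)
        (fun a m' => kernelVertex 𝕜 (deg := fun _ : Fin n => 2 * m') (fun _ => even_two_mul m') (fun b => replicaKer 𝕜 (K m') b) a)
        (fun a m' => coe_kernelVertex_replicaKer_mem 𝕜 m' (K m') a) ⟨0, hn⟩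
      exact h
    rw [← hC', h2, AddSubmonoidClass.coe_finsetSum, map_sum]
  -- the bound per degree assignment and pinned copy
  have hδ : ∀ (δ : Fin n → ℕ) (b : Fin n),
      ∑ W' ∈ univ.filter (fun W' : Fin r → Fin n × Γ => W' i = (b, w) ∧ ∀ j ∈ J, A j (W' j).2 = true),
        wt ((univ.image W').image Prod.snd) * ‖kernel 𝕜 (U δ : GrassmannAlgebra 𝕜 (Fin n × Γ)) r W'‖ ≤ B δ := by
    intro δ b
    have hGB' : IsGramBounded C' κ := by rw [hC']; exact (hGB.submatrix Prod.snd).isGramBounded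
    have hKs : ∀ (v : Fin n) (Yv : Fin (2 * δ v) → Fin n × Γ), replicaKer 𝕜 (K (δ v)) v Yv ≠ 0 → ∀ j, (Yv j).1 = v :=
      fun v Yv h j => replicaKer_support 𝕜 (K (δ v)) v Yv h j
    rw [hB]
    dsimp only
    split_ifs with hle
    · exact sum_wt_norm_kernel_ursellOf_kernelVertex_le_prescribed C' (Prod.fst : Fin n × Γ → Fin n) (fun b => replicaKer 𝕜 (K (δ b)) b)
        hwt' hκ hGB' (fun b => even_two_mul (δ b)) hKs J (fun j X' => A j X'.2) (fun u F => N (δ u) F) (fun u F => hN0 _ _)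
        (fun u T hT ι hι t ht a' => sum_filter_wt_norm_replicaKer_le_prescribed hwt (K (δ u)) u A T ι t
          (fun w' => hN (δ u) T hT ι hι t ht w') a')
        hα (fun ℓ X' => sum_wt_norm_typeRestrict_submatrix_le C hα hrow ℓ X')
        (fun ℓ Y' => sum_wt_norm_typeRestrict_submatrix_le' C hα hcol ℓ Y') (hlam δ) i hi (b, w)
    · refine le_of_eq (sum_eq_zero fun W' _ => ?_)
      rw [hU]
      dsimp only
      rw [kernel_ursellOf_kernelVertex_eq_zero_of_lt_of_gramBounded C' (Prod.fst : Fin n × Γ → Fin n) (fun b => replicaKer 𝕜 (K (δ b)) b)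
        hκ hGB' (fun b => even_two_mul (δ b)) hKs ⟨0, hn⟩ (not_le.1 hle) W', norm_zero, mul_zero]
  -- assemble
  calc ∑ W ∈ univ.filter (fun W : Fin r → Γ => W i = w ∧ ∀ j ∈ J, A j (W j) = true), wt (univ.image W) *
          ‖kernel 𝕜 ((cumulantOf (fun k => evenGaussConv 𝕜 C (vertexOf 𝕜 degs K ^ k)) n : evenPart 𝕜 Γ) : GrassmannAlgebra 𝕜 Γ) r W‖
      ≤ ∑ W ∈ univ.filter (fun W : Fin r → Γ => W i = w ∧ ∀ j ∈ J, A j (W j) = true), ∑ δ ∈ Fintype.piFinset (fun _ : Fin n => degs),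
          wt (univ.image W) * ‖kernel 𝕜 (collapse 𝕜 (Prod.snd : Fin n × Γ → Γ) (U δ : GrassmannAlgebra 𝕜 (Fin n × Γ))) r W‖ := by
        refine sum_le_sum fun W _ => ?_
        rw [hcum, kernel_sum, ← mul_sum]
        exact mul_le_mul_of_nonneg_left (norm_sum_le _ _) (hwt.nonneg _)
    _ = ∑ δ ∈ Fintype.piFinset (fun _ : Fin n => degs), ∑ W ∈ univ.filter (fun W : Fin r → Γ => W i = w ∧ ∀ j ∈ J, A j (W j) = true),
          wt (univ.image W) * ‖kernel 𝕜 (collapse 𝕜 (Prod.snd : Fin n × Γ → Γ) (U δ : GrassmannAlgebra 𝕜 (Fin n × Γ))) r W‖ := sum_comm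
    _ ≤ ∑ δ ∈ Fintype.piFinset (fun _ : Fin n => degs), ∑ _b : Fin n, B δ :=
        sum_le_sum fun δ _ => (sum_filter_wt_norm_kernel_collapse_le_prescribed hwt _ i w J A).trans (sum_le_sum fun b _ => hδ δ b)
    _ = (n : ℝ) * ∑ δ ∈ Fintype.piFinset (fun _ : Fin n => degs), B δ := by
        rw [mul_sum]
        exact sum_congr rfl fun δ _ => by rw [sum_const, card_univ, Fintype.card_fin, nsmul_eq_mul]

end Literature.MathematicalPhysics.QuantumLattice
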